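/-
Copyright (c) 2026 the pub-hodgecm-mathlib formalisation cell (harness21).  Prover seat hodgecm-mathlib-K2Liu-p10 (g4), Track B «K2-LIT»,
#184♮ = hLiu418 = `stmt-HodgeConjecture-24832`; organ S2 «ARCH SPAN BY K-TYPE PATHS», file S2-K K-2a (LEAD F0P6-plan (g14) RULING M-158f, BATCH #10 (3);
DESIGN-S2 §3 (i) «joint eigenspaces of Euler degree + Casimir»; ref1 (K-iii) / (r2′) «`Cas = (k+l)²+l²+k`, injectivity via `2c − (k+2l)² = k²+2k`»).  KERNEL: theorems only.
-/
import Summits.HodgeConjecture.HodgeConjecture.Theorems.K2LiuU22KTypeStability   -- ★ K-1b p860176 (`rOp_dz_mul_bil_pow`, `rOp_mul`, `rOp_bil`, stability; brings K-1, DEFS leaf)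
import Mathlib.Tactic.LinearCombination
import HarnessLib

/-!
# Crux `HLiu418`, organ S2, file S2-K K-2a: THE EULER AND CASIMIR EIGENVALUES OF THE K-TYPES
# `E|_{W_{(k+l,l)}} = k + 2l`, `C|_{W_{(k+l,l)}} = (k+l)² + l² + k`, and `(k,l) ↦ (E, C)` is injective

Cell `hodgecm-mathlib`, crux item hLiu418 = `stmt-HodgeConjecture-24832`, route of record `HCCMUnconditional`; squad K2 ∕ K2Liu, prover K2Liu-p10 (g4).
THEOREMS ONLY (no `def`, no `instance`, no notation, no named-fact hypothesis, no `sorry`); lane `--supports stmt-HodgeConjecture-24832 --as helper`.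

The Euler operator `E = Σ u_{ij}∂_{ij} = Σ_a R_{aa}` and the right Casimir `C = Σ_{ab} R_{ab}R_{ba}` (★ DEFS leaf `euler`, `casimir`) act on the K-type `W_{(k+l,l)} = kType k l`
by the scalars `k + 2l` and `(k+l)² + l² + k = λ₁² + λ₂² + λ₁ − λ₂` (ref1 PREP-S2 §1, checked on the generators `D^l (ξuη)^k` by the generator formula ★ `rOp_dz_mul_bil_pow`),
and the pair of eigenvalues SEPARATES the K-types (`2C − E² = k² + 2k` is strictly increasing in `k ∈ ℕ`).  This is the input of the component-extraction lemma of K-2b.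
* §1 `bil_eq_sum_single` (`ξuη = η₀ (ξue₀) + η₁ (ξue₁)`), **`euler_eq_smul_of_mem`**: `f ∈ W k l ⇒ E f = (k + 2l) • f`;
* §2 **`casimir_eq_smul_of_mem`**: `f ∈ W k l ⇒ C f = ((k+l)² + l² + k) • f`;
* §3 **`eq_of_eigenvalues_eq`**: `k + 2l = k′ + 2l′ ∧ (k+l)²+l²+k = (k′+l′)²+l′²+k′ ⇒ (k,l) = (k′,l′)`.

HONEST LABEL: HC_CM is proved only modulo the 7 printed citations (2 remaining named inputs: hLiu418 = stmt-HodgeConjecture-24832, h413 = stmt-HodgeConjecture-24833)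
until rung 0 closes; helper, closes no item.
References: [LeeZhu1998] S. T. Lee, C.-B. Zhu, Trans. AMS 350 (1998) p. 5032; [KashiwaraVergne1978] Invent. Math. 44 (1978) §II.5; [Howe1989Remarks] Trans. AMS 313 (1989) §2.
-/

set_option autoImplicit false
set_option linter.dupNamespace false -- the mandated namespace repeats `HodgeConjecture.HodgeConjecture`

noncomputable section

open Matrix
open Summit.HodgeConjecture.HodgeConjecture.Cruxes.HLiu418.K2LiuU22CompactPictureDefs
open Summit.HodgeConjecture.HodgeConjecture.Cruxes.HLiu418.K2LiuU22KTypeMembership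
open Summit.HodgeConjecture.HodgeConjecture.Cruxes.HLiu418.K2LiuU22KTypeStability

namespace Summit.HodgeConjecture.HodgeConjecture.Cruxes.HLiu418.K2LiuU22KTypeEigenvalues

/-! ## §1 The Euler eigenvalue `k + 2l` -/

/-- `ξ·u·η = η₀·(ξ·u·e₀) + η₁·(ξ·u·e₁)`. [folklore] -/
theorem bil_eq_sum_single {R : Type*} [CommRing R] [Algebra ℂ R] (u : Matrix (Fin 2) (Fin 2) R) (ξ η : Fin 2 → ℂ) :
    bil u ξ η = η 0 • bil u ξ (Pi.single 0 1) + η 1 • bil u ξ (Pi.single 1 1) := by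
  simp only [bil, Fin.sum_univ_two, Pi.single_eq_same, Pi.single_eq_of_ne (zero_ne_one : (0 : Fin 2) ≠ 1),
    Pi.single_eq_of_ne (one_ne_zero : (1 : Fin 2) ≠ 0), mul_one, mul_zero, zero_smul, add_zero, zero_add, smul_add, smul_smul]
  ring_nf

/-- two `ℂ`-linear maps agreeing on the generators `D^l (ξuη)^k` agree on `W_{(k+l,l)}`. [folklore] -/
theorem eq_on_kType {T T' : Carrier →ₗ[ℂ] Carrier} (k : ℕ) (l : ℤ) (h : ∀ ξ η : Fin 2 → ℂ, T (dz l * bil uMat ξ η ^ k) = T' (dz l * bil uMat ξ η ^ k))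
    {f : Carrier} (hf : f ∈ kType k l) : T f = T' f := by
  have hle : kType k l ≤ LinearMap.eqLocus T T' := Submodule.span_le.2 (by rintro _ ⟨ξ, η, rfl⟩; exact h ξ η)
  exact hle hf

/-- **THE EULER EIGENVALUE**: `E f = (k + 2l) • f` for `f ∈ W_{(k+l,l)}` (`E = Σ_a R_{aa}`; on a generator `Σ_a R_{aa}(D^l(ξuη)^k) = 2l·(…) + k·Σ_a η_a D^l (ξuη)^{k−1}(ξue_a) = (2l + k)(…)`).
[cite: KashiwaraVergne1978, §II.5] [cite: LeeZhu1998, p. 5032] -/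
theorem euler_eq_smul_of_mem (k : ℕ) (l : ℤ) {f : Carrier} (hf : f ∈ kType k l) : euler pd uMat f = ((k : ℂ) + 2 * (l : ℂ)) • f := by
  refine eq_on_kType (T := euler pd uMat) (T' := ((k : ℂ) + 2 * (l : ℂ)) • LinearMap.id) k l (fun ξ η => ?_) hf
  rw [LinearMap.smul_apply, LinearMap.id_apply, euler_eq_sum_rOp, Fin.sum_univ_two, rOp_dz_mul_bil_pow, rOp_dz_mul_bil_pow, if_pos rfl, if_pos rfl]
  rcases Nat.eq_zero_or_pos k with rfl | hk
  · simp only [Nat.cast_zero, zero_mul, zero_smul, add_zero, zero_add, pow_zero, mul_one, ← add_smul]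
    ring_nf
  · obtain ⟨m, rfl⟩ := Nat.exists_eq_add_of_le hk
    have hB := bil_eq_sum_single uMat ξ η
    simp only [Nat.add_sub_cancel_left, Algebra.smul_def, map_add, map_mul, map_natCast, map_ofNat, Nat.cast_add, Nat.cast_one] at hB ⊢
    rw [hB]
    ring

/-! ## §2 The Casimir eigenvalue `(k+l)² + l² + k` -/

/-- the `𝔤𝔩₂` fields kill the integers of `R`. [folklore] -/
theorem rOp_natCast {R : Type*} [CommRing R] [Algebra ℂ R] (d : Fin 2 → Fin 2 → Derivation ℂ R R) (u : Matrix (Fin 2) (Fin 2) R) (a b : Fin 2) (n : ℕ) :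
    rOp d u a b (n : R) = 0 := by
  rw [← nsmul_one, map_nsmul, rOp_one, nsmul_zero]

/-- **THE CASIMIR ON A GENERATOR**: `C (D^l (ξuη)^k) = ((k+l)² + l² + k) · D^l (ξuη)^k` — Leibniz all the way down (★ `rOp_mul`, `rOp_pow`, `rOp_dz`, `rOp_bil`) and
`ξuη = η₀(ξue₀) + η₁(ξue₁)`; the three cases `k = 0, 1, m+2` keep the exponents concrete for `ring`. [cite: LeeZhu1998, p. 5032] [cite: KashiwaraVergne1978, §II.5] -/
theorem casimir_gen (k : ℕ) (l : ℤ) (ξ η : Fin 2 → ℂ) :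
    casimir pd uMat (dz l * bil uMat ξ η ^ k) = ((((k : ℂ) + l) ^ 2 + (l : ℂ) ^ 2 + k)) • (dz l * bil uMat ξ η ^ k) := by
  have hB := bil_eq_sum_single uMat ξ η
  rw [casimir_apply]
  simp only [Fin.sum_univ_two, rOp_mul, rOp_pow, rOp_dz, rOp_natCast, rOp_bil pd uMat pd_uMat, map_add, map_smul, map_zero, add_zero,
    mul_zero, zero_mul, if_true, if_neg (zero_ne_one : (0 : Fin 2) ≠ 1), if_neg (one_ne_zero : (1 : Fin 2) ≠ 0), Pi.single_eq_same, one_smul]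
  simp only [Algebra.smul_def, map_add, map_natCast, map_intCast, map_pow] at hB ⊢
  rw [hB]
  rcases k with _ | _ | m
  · simp only [pow_zero, Nat.cast_zero]
    ring
  · simp only [zero_add, pow_one, Nat.sub_self, pow_zero, Nat.cast_one, Nat.cast_zero]
    ring
  · simp only [Nat.add_sub_cancel, show m + 2 - 1 = m + 1 from rfl, Nat.cast_add, Nat.cast_one, pow_succ]
    ring

/-- **THE CASIMIR EIGENVALUE**: `C f = ((k+l)² + l² + k) • f` for `f ∈ W_{(k+l,l)}` (`= λ₁² + λ₂² + λ₁ − λ₂`, ref1 PREP-S2 §1 with `λ = (k+l, l)`).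
[cite: LeeZhu1998, p. 5032] [cite: KashiwaraVergne1978, §II.5] -/
theorem casimir_eq_smul_of_mem (k : ℕ) (l : ℤ) {f : Carrier} (hf : f ∈ kType k l) :
    casimir pd uMat f = ((((k : ℂ) + l) ^ 2 + (l : ℂ) ^ 2 + k)) • f := by
  refine eq_on_kType (T := casimir pd uMat) (T' := ((((k : ℂ) + l) ^ 2 + (l : ℂ) ^ 2 + k)) • LinearMap.id) k l (fun ξ η => ?_) hf
  rw [LinearMap.smul_apply, LinearMap.id_apply, casimir_gen]

/-! ## §3 The pair `(E, C)` separates the K-types -/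

/-- **INJECTIVITY**: the Euler and Casimir eigenvalues determine `(k, l)` (`2C − E² = k² + 2k` is strictly increasing in `k ∈ ℕ`, then `E` gives `l`).
[cite: LeeZhu1998, p. 5032] -/
theorem eq_of_eigenvalues_eq {k k' : ℕ} {l l' : ℤ} (hE : ((k : ℂ) + 2 * (l : ℂ)) = (k' : ℂ) + 2 * (l' : ℂ))
    (hC : (((k : ℂ) + l) ^ 2 + (l : ℂ) ^ 2 + k) = (((k' : ℂ) + l') ^ 2 + (l' : ℂ) ^ 2 + k')) : k = k' ∧ l = l' := by
  have hE' : (k : ℤ) + 2 * l = (k' : ℤ) + 2 * l' := by exact_mod_cast hE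
  have hC' : ((k : ℤ) + l) ^ 2 + l ^ 2 + k = ((k' : ℤ) + l') ^ 2 + l' ^ 2 + k' := by exact_mod_cast hC
  have hsq : ((k : ℤ) + 2 * l) ^ 2 = ((k' : ℤ) + 2 * l') ^ 2 := by rw [hE']
  have hq : (k : ℤ) ^ 2 + 2 * k = (k' : ℤ) ^ 2 + 2 * k' := by linear_combination 2 * hC' - hsq
  have hk0 : (0 : ℤ) ≤ k := by positivity
  have hk0' : (0 : ℤ) ≤ k' := by positivity
  have hk : k = k' := by
    rcases lt_trichotomy k k' with h | h | h
    · exfalso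
      have h' : (k : ℤ) + 1 ≤ k' := by exact_mod_cast h
      nlinarith [hq, h', hk0, hk0']
    · exact h
    · exfalso
      have h' : (k' : ℤ) + 1 ≤ k := by exact_mod_cast h
      nlinarith [hq, h', hk0, hk0']
  subst hk
  exact ⟨rfl, by linarith⟩

end Summit.HodgeConjecture.HodgeConjecture.Cruxes.HLiu418.K2LiuU22KTypeEigenvalues

end
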